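import Literature.IUT.HodgeTheaters.TemperedCoveringsCor23iiiOfSpecialFibreHPrimeAdmissibleKernel
import Literature.AnabelianGeometry.EtaleTheta.SettingModelTateTheta
import Literature.AnabelianGeometry.SemiGraphs.ProSigmaCompletionTransport
import HarnessLib

/-!
# The input (x) of the [IUTchI] Cor. 2.3 (iii)/(iv) `_primes` headlines PRODUCED at the Tate datum of record
# `ThetaSetting.modelχq p i j` (`X := curveχq p i j`): `Δ̂_X(modelχq)` is the profinite completion of the free group `F₂`

Mochizuki, *Inter-universal Teichmüller theory I*, kurims manuscript (May 2020), §2, Cor. 2.3 (iii) p. 47, proof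
pp. 48–49 [cite: Mochizuki2012, Cor 2.3(iii) pp.47-49] (D-0012 claim key; series status DISPUTED; nothing of the series
is asserted); Mochizuki, *The étale theta function …*, Publ. RIMS **45** (2009), §1 p. 12 ("`Δ_X` … a profinite free
group on 2 generators") [cite: MochizukiEtTh2009, §1 p.12].

PROOF-ONLY file (abc-iut cell; seat abc-iut-w4-d058 gen 13, row «COR23III-TOWER-RECLOSE», KEY 53c222789249ad97; fragment
(B1) of the Stage-1 memo `COR23III-TOWER-RECLOSE.md` sha16 77a6f55d1092dc98, chair abc-iut-L5-lead RULINGS #388/#389;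
no definition, no instance, no new `Prop` fact):
* `exists_isProSigmaCompletion_primes_deltaHat_curveχq` — the binder (x) `hι : IsProSigmaCompletion {q ∣ q.Prime} ι`
  (FACT row F-2528) of the headlines `…_of_hPrime_of_admissibleKer_ne_bot_primes` (abc-iut-w4-d058 p493071 over
  abc-iut-w4-d052 p491651) PRODUCED into `X.DeltaHat` for the GENUINE `TemperedCurve` term `X := curveχq p i j`
  (abc-iut-w5-d249, `SettingModelTateSemidirect`; `= (ThetaSetting.modelχq p i j hj).toTemperedCurve`): `F₂ → F̂₂ ≃ Δ̂_X`
  through `deltaHatχqEquiv`, abc-iut-L3-t2's `isProSigmaCompletion_toCompletion` transported; `F₂` nonabelian.  The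
  companion FACT row F-2551 is the term's own field, the tree theorem `isProfiniteCompletion_toHatχq`.
* `exists_isProSigmaCompletion_primes_ofSpecialFibre_deltaHat_curveχq` — the same INTO the tower carrier
  `(ofSpecialFibre (curveχq p i j) d S …).DeltaHat` (`= X.DeltaHat`, abc-iut-L5's `OfSpecialFibre.ker_augHatGK_eq_deltaHat`),
  for ALL `d`, `S`, `h36`, labels `Σ ⊆ Σ̂`, `TpH`, `cuspMeetsH` — exactly the shape the headline consumes.

HONEST LABEL (director-abc g15-D12 / chair RULINGS #388 (3), #389, verbatim): «binder-level NV at Δ̂_X of the Tate datum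
of record (semi-synthetic model modelχq); F-2528 produced into Δ̂_X and into the tower carrier, F-2551 = the term's field;
NOT the closer; joint inhabitation of T/P at modelχq OPEN (memo O6); K4 does not flip; not a genuine Tate curve;
FOUNDATIONS 13/14 not claimed; [claim: Mochizuki2012, status: disputed] for the print statement».  In particular this is
NOT «NV at the datum of record»: the remaining binders of the headline (`T : SpecialFibreTower X.DeltaTemp` with
`P : PiData`, `S`, `hind`, `hTpH`, `hK`) are NOT produced here (memo `COR23III-TOWER-RECLOSE.md` §3: at
`Δ^tp(modelχq) = F̂₂⁰ ⋊ ℤ` every level chart is forced profinite and no G_{ℚ_p}-stable slim co-compact level chain is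
constructible with the tree's means).  No side is taken on [IUTchIII] Cor. 3.12; nothing here asserts that abc is
proved or refuted.
-/

noncomputable section

namespace Literature.IUT.HodgeTheaters

open _root_.Topology
open scoped Pointwise
open Literature.AnabelianGeometry.SemiGraphs
open Literature.AnabelianGeometry.SemiGraphs.SemiGraphOfAnabelioids (IsProSigmaCompletion)
open Literature.AnabelianGeometry.EtaleTheta
open Literature.AnabelianGeometry.EtaleTheta.SettingModel

namespace StableCurveTemperedData

/-! ### (x) at the Tate datum of record -/

/-- `F₂` is nonabelian (the generators map to non-commuting transpositions of `S₃`). [folklore] -/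
private theorem freeGroupTwo_nonabelian_χq : ∃ x y : FreeGroup (Fin 2), x * y ≠ y * x := by
  refine ⟨FreeGroup.of 0, FreeGroup.of 1, fun h => ?_⟩
  let f : Fin 2 → Equiv.Perm (Fin 3) := fun i => if i = 0 then Equiv.swap 0 1 else Equiv.swap 1 2
  have h' := congrArg (FreeGroup.lift f) h
  simp only [map_mul, FreeGroup.lift_apply_of, f] at h'
  exact absurd h' (by decide)

section Datum

variable (p : ℕ) [Fact p.Prime] (i j : ℤ)

/-- **(x) at the Tate datum of record: `Δ̂_X(curveχq p i j)` is the profinite (= pro-`𝔓𝔯𝔦𝔪𝔢𝔰`) completion of the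
nonabelian free group `F₂`** — `F₂ → F̂₂ ≃ Δ̂_X` through abc-iut-w5-d249's `deltaHatχqEquiv`; a closed producer of the
FACT binder `IsProSigmaCompletion` (F-2528) into `X.DeltaHat` for the genuine `TemperedCurve` term `X := curveχq p i j`
(F-2551 = the term's field `isProfiniteCompletion_toHatχq`).  «binder-level NV at Δ̂_X of the Tate datum of record
(semi-synthetic model modelχq); NOT the closer; joint inhabitation of T/P at modelχq OPEN; K4 does not flip; not a genuine
Tate curve; FOUNDATIONS 13/14 not claimed». [cite: MochizukiEtTh2009, §1 p.12] -/
theorem exists_isProSigmaCompletion_primes_deltaHat_curveχq :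
    ∃ ι : FreeGroup (Fin 2) →* (curveχq p i j).DeltaHat,
      IsProSigmaCompletion {q : ℕ | q.Prime} ι ∧ ∃ x y : FreeGroup (Fin 2), x * y ≠ y * x := by
  have hη : IsProSigmaCompletion {q : ℕ | q.Prime} (toCompletion (FreeGroup (Fin 2))) :=
    SemiGraphOfAnabelioids.IsProSigmaCompletion.isProSigmaCompletion_toCompletion (FreeGroup (Fin 2))
  exact ⟨(deltaHatχqEquiv p i j).toMulEquiv.toMonoidHom.comp (toCompletion (FreeGroup (Fin 2))),
    hη.comp_continuousMulEquiv (deltaHatχqEquiv p i j), freeGroupTwo_nonabelian_χq⟩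

variable (d : (curveχq p i j).GroupLevelData)
  (S : SpecialFibreData ((curveχq p i j).toTemperedArithmeticGroup d)) (h36 : S.Gc.Prop36Hypotheses)
  (Sigma SigmaHat : Set ℕ) (hsub : Sigma ⊆ SigmaHat) (hne : Sigma.Nonempty)
  (hprime : ∀ q ∈ SigmaHat, q.Prime) (hp : p ∉ Sigma)
  (TpH : Subgroup S.chart.G)
  (cuspMeetsH : {x : (curveχq p i j).Pt // (curveχq p i j).IsCusp x} → Prop)

/-- **(x) INTO the tower carrier** `(ofSpecialFibre (curveχq p i j) d S …).DeltaHat = Δ̂_X`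
(`OfSpecialFibre.ker_augHatGK_eq_deltaHat`), for all `d`, `S`, `h36`, labels, `TpH`, `cuspMeetsH` — the exact shape the
`_primes` headlines consume.  «binder-level NV only; NOT the closer; T/P existence at modelχq OPEN; [claim: Mochizuki2012,
status: disputed] for the print statement». [cite: Mochizuki2012, Cor 2.3(iii) pp.47-49] -/
theorem exists_isProSigmaCompletion_primes_ofSpecialFibre_deltaHat_curveχq :
    ∃ ι : FreeGroup (Fin 2) →* (ofSpecialFibre (curveχq p i j) d S h36 Sigma SigmaHat hsub hne hprime hp TpH
        ((TpH.map (TemperedGraphGroupData.exists_completion_of_prop36 S.Gc h36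
          S.chart).choose_spec.choose.toMonoidHom).topologicalClosure) (Subgroup.le_topologicalClosure _)
        cuspMeetsH).DeltaHat,
      IsProSigmaCompletion {q : ℕ | q.Prime} ι := by
  have hη : IsProSigmaCompletion {q : ℕ | q.Prime} (toCompletion (FreeGroup (Fin 2))) :=
    SemiGraphOfAnabelioids.IsProSigmaCompletion.isProSigmaCompletion_toCompletion (FreeGroup (Fin 2))
  have heq : (curveχq p i j).DeltaHat = (OfSpecialFibre.augHatGK (curveχq p i j)).ker :=
    (OfSpecialFibre.ker_augHatGK_eq_deltaHat (curveχq p i j) d).symm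
  let e₃ : (curveχq p i j).DeltaHat ≃ₜ* (OfSpecialFibre.augHatGK (curveχq p i j)).ker :=
    { MulEquiv.subgroupCongr heq with
      continuous_toFun := (continuous_subtype_val).subtype_mk _
      continuous_invFun := (continuous_subtype_val).subtype_mk _ }
  exact ⟨(e₃.toMulEquiv.toMonoidHom).comp
      ((deltaHatχqEquiv p i j).toMulEquiv.toMonoidHom.comp (toCompletion (FreeGroup (Fin 2)))),
    (hη.comp_continuousMulEquiv (deltaHatχqEquiv p i j)).comp_continuousMulEquiv e₃⟩

end Datum

end StableCurveTemperedData

end Literature.IUT.HodgeTheaters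

end
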